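import Literature.NumberTheory.Transcendental.PadicCW77KStep
import HarnessLib

/-!
# Cell abc-stewartyu, Gen-3 frame at `p = 2` (crux `Y07Two`, stmt-ABC-19659): WEIGHTED NODE SEQUENCES for the
# small-jets Schwarz lemma, and the count of the integer nodes coprime to `3`

`Summits/ABC/StewartYu/PadicG3NodeSeq.lean` — cell `abc-stewartyu` (HOME `run/shared/lean/pub/abc-stewartyu/`),
route `PadicPrimesKummerThird`, seat p5 (g3); place-free list/`Finset` combinatorics consumed by
`PadicG3TwoSlabKStepOn` (the `2`-adic k-step from an arbitrary node set).  One definition (`nodeSeqW`), theorems.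

Lit's `PadicCW77.nodeSeq node kpts t` lists the `kpts` nodes each `t` times; when only the nodes of a subset
`Z ⊆ [−N, N]` carry zeros (after a `q = 3` Kummer descent: the integers coprime to `3`, Yu 2013 proof of
Lemma 5.4; Nesterenko 2003 §4.1 stage `ν = 0`: the odd integers), the node list of
`PadicNewton.norm_tsum_le_max_of_small_jets_levels` is the WEIGHTED sequence `nodeSeqW node w kpts` (`node i`
repeated `w i` times, `w` = `t`·indicator of `Z`), with the same four counting lemmas (`length`, `mem`, `count`,
`countP`) as lit's, the index/value bijection `card_filter_range_sub_mem`, and the count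
`card_Icc_filter_not_three_dvd : #{x ∈ [−N, N] : 3 ∤ x} = 2(N − ⌊N/3⌋)`.

WHAT THIS IS NOT: no analysis; no crux moves.

References: K. Yu, Compositio Math. 74 (1990), §3; K. Yu, Acta Math. 211 (2013), proof of Lemma 5.4.
-/

open Finset

namespace Summit.ABC.StewartYu

/-! ### Weighted node sequences -/

namespace G3Nodes

/-- The WEIGHTED node sequence `node 0, …, node 0, node 1, …` (`node i` repeated `w i` times, `i < kpts`) —
the node list of the small-jets Schwarz lemma when only some of the `kpts` nodes carry zeros. [cite: Yu1990, §3] -/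
def nodeSeqW {K : Type*} (node : ℕ → K) (w : ℕ → ℕ) (kpts : ℕ) : List K :=
  (List.range kpts).flatMap fun i => List.replicate (w i) (node i)

/-- Length of the weighted node sequence. [folklore] -/
theorem length_nodeSeqW {K : Type*} (node : ℕ → K) (w : ℕ → ℕ) (kpts : ℕ) :
    (nodeSeqW node w kpts).length = ∑ i ∈ range kpts, w i := by
  induction kpts with
  | zero => simp [nodeSeqW]
  | succ k ih =>
    unfold nodeSeqW at ih ⊢
    rw [List.range_succ, List.flatMap_append, List.length_append, ih, Finset.sum_range_succ]
    simp

/-- Members of the weighted node sequence are nodes of nonzero weight. [folklore] -/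
theorem mem_nodeSeqW {K : Type*} {node : ℕ → K} {w : ℕ → ℕ} {kpts : ℕ} {x : K}
    (hx : x ∈ nodeSeqW node w kpts) : ∃ i < kpts, w i ≠ 0 ∧ x = node i := by
  unfold nodeSeqW at hx
  rw [List.mem_flatMap] at hx
  obtain ⟨i, hi, hx⟩ := hx
  rw [List.mem_replicate] at hx
  exact ⟨i, List.mem_range.mp hi, hx.1, hx.2⟩

/-- Multiplicity in the weighted node sequence (injective `node`). [folklore] -/
theorem count_nodeSeqW {K : Type*} [DecidableEq K] {node : ℕ → K} (hnode : Function.Injective node)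
    (w : ℕ → ℕ) : ∀ (kpts i : ℕ), (nodeSeqW node w kpts).count (node i) = if i < kpts then w i else 0 := by
  intro kpts
  induction kpts with
  | zero => intro i; simp [nodeSeqW]
  | succ k ih =>
    intro i
    unfold nodeSeqW at ih ⊢
    rw [List.range_succ, List.flatMap_append, List.count_append, ih i, List.flatMap_cons,
      List.flatMap_nil, List.append_nil, List.count_replicate]
    by_cases hik : i < k
    · have hne : (node k == node i) = false := by
        rw [beq_eq_false_iff_ne]; exact fun h => by have := hnode h; omega
      rw [hne, if_pos hik, if_pos (Nat.lt_succ_of_lt hik)]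
      simp
    · by_cases hik' : i = k
      · subst hik'
        rw [if_neg hik, beq_self_eq_true, if_pos (Nat.lt_succ_self i)]
        simp
      · have hne : (node k == node i) = false := by
          rw [beq_eq_false_iff_ne]; exact fun h => hik' (hnode h).symm
        have hlt : ¬ i < k + 1 := by omega
        simp [hne, hik, hlt]

/-- `countP` over the weighted node sequence. [folklore] -/
theorem countP_nodeSeqW {K : Type*} (node : ℕ → K) (w : ℕ → ℕ) (q : K → Bool) :
    ∀ kpts : ℕ, (nodeSeqW node w kpts).countP q = ∑ i ∈ range kpts, if q (node i) then w i else 0 := by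
  intro kpts
  induction kpts with
  | zero => simp [nodeSeqW]
  | succ k ih =>
    unfold nodeSeqW at ih ⊢
    rw [List.range_succ, List.flatMap_append, List.countP_append, ih, Finset.sum_range_succ,
      List.flatMap_cons, List.flatMap_nil, List.append_nil, List.countP_replicate]

/-- The indices `i < 2N+1` with `i − N ∈ Z` are in bijection with `Z ⊆ [−N, N]`. [folklore] -/
theorem card_filter_range_sub_mem (N : ℕ) (Z : Finset ℤ) (hZ : ∀ x ∈ Z, |x| ≤ (N : ℤ)) :
    ((range (2 * N + 1)).filter fun i : ℕ => ((i : ℤ) - N) ∈ Z).card = Z.card := by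
  refine Finset.card_bij (fun i _ => (i : ℤ) - N) (fun i hi => (Finset.mem_filter.mp hi).2)
    (fun i hi i' hi' h => by
      have : (i : ℤ) = i' := by linarith
      exact_mod_cast this)
    (fun x hx => ?_)
  have hx' := hZ x hx
  rw [abs_le] at hx'
  refine ⟨(x + N).toNat, ?_, ?_⟩
  · rw [Finset.mem_filter, Finset.mem_range]
    constructor
    · have : (x + N).toNat = x + N := Int.toNat_of_nonneg (by omega)
      omega
    · rw [Int.toNat_of_nonneg (by omega)]
      simpa using hx
  · rw [Int.toNat_of_nonneg (by omega)]; ring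

/-- **The coprime nodes**: `#{x ∈ [−N, N] : 3 ∤ x} = 2·(N − ⌊N/3⌋)` (hence `≥ 4N/3`). [folklore] -/
theorem card_Icc_filter_not_three_dvd (N : ℕ) :
    ((Finset.Icc (-(N : ℤ)) N).filter fun x => ¬ (3 : ℤ) ∣ x).card = 2 * (N - N / 3) := by
  have htot : (Finset.Icc (-(N : ℤ)) N).card = 2 * N + 1 := by
    rw [Int.card_Icc]; omega
  have hdiv : ((Finset.Icc (-(N : ℤ)) N).filter fun x => (3 : ℤ) ∣ x).card = 2 * (N / 3) + 1 := by
    have e : (Finset.Icc (-(N : ℤ)) N).filter (fun x => (3 : ℤ) ∣ x) =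
        (Finset.Icc (-((N / 3 : ℕ) : ℤ)) ((N / 3 : ℕ) : ℤ)).image (fun k => 3 * k) := by
      ext x
      simp only [Finset.mem_filter, Finset.mem_Icc, Finset.mem_image]
      constructor
      · rintro ⟨⟨h1, h2⟩, ⟨k, rfl⟩⟩
        exact ⟨k, ⟨by omega, by omega⟩, rfl⟩
      · rintro ⟨k, ⟨h1, h2⟩, rfl⟩
        exact ⟨⟨by omega, by omega⟩, ⟨k, rfl⟩⟩
    have hinj : Function.Injective fun k : ℤ => 3 * k := fun a b h => by
      simp only at h; omega
    rw [e, Finset.card_image_of_injective _ hinj, Int.card_Icc]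
    omega
  have h := Finset.card_filter_add_card_filter_not
    (s := Finset.Icc (-(N : ℤ)) N) (fun x => (3 : ℤ) ∣ x)
  rw [htot, hdiv] at h
  omega

/-- Every `x ∈ [−N, N]` has `|x| ≤ N`. [folklore] -/
theorem abs_le_of_mem_Icc {N : ℕ} {x : ℤ} (hx : x ∈ Finset.Icc (-(N : ℤ)) N) : |x| ≤ (N : ℤ) := by
  rw [Finset.mem_Icc] at hx; exact abs_le.mpr hx

end G3Nodes

end Summit.ABC.StewartYu
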